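import Literature.AlgebraicGeometry.Morphisms.ProjectiveOfPushforwardFrameFieldExtension
import Literature.AlgebraicGeometry.Morphisms.SectionsProjectiveOfFibreVanishing
import Literature.AlgebraicGeometry.Morphisms.QuasiCompactPushforwardCoh
import Literature.AlgebraicGeometry.Modules.KernelFiniteLocallyFree
import Literature.AlgebraicGeometry.Motives.GeneratingSectionsFrameChange
import HarnessLib

/-!
# EGA III 4.7.1 over a LOCAL Noetherian base: fibrewise complete-linear-system embeddings make `f` projective

Informal result. Let `A` be a Noetherian local ring, `f : X → Spec A` proper and flat, `E` an `𝒪_X`-module with a rank-one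
frame system (a line bundle with chosen local generators) such that `H¹`-type vanishing `Ext¹(𝒪, E|_{X₀}) = 0` holds on every
cartesian fibre `X₀ = X ×_{Spec A} Spec K` over a field point, and such that every point `t ∈ Spec A` admits a field extension
`κ(t) → K` over which the fibre `X_K` is embedded into `ℙⁿ_K` by finitely many sections of `E|_{X_K}` (a complete-linear-system
embedding of the fibre).  Then `f` is PROJECTIVE (a closed immersion into some `ℙ^m_{Spec A}` over `Spec A`).
This is EGA III 4.7.1 / Mumford §5 Cor. 3 («`L` ample on the closed fibre ⇒ `L` ample») in the form the tree uses
(`Literature.AlgebraicGeometry.Morphisms.IsProjective`); the typical consumer takes `A` Artin local and `E` a power of a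
lifted polarisation ([Hartshorne1977, III Ex. 5.7 (b)], [MumfordAV1970, §5 Cor. 3]).

Proof (assembled from tree capital).  By Mumford §5 Cor. 2 (★ `finite_and_projective_secMod_top_of_forall_fiber`) `Γ(X, E)` is a
finitely generated projective `Γ(Spec A, 𝒪)`-module; the base being LOCAL it is free (Mathlib `Module.free_of_flat_of_isLocalRing`),
and a basis is a FRAME `𝒪^k ≅ f_* E` (★ `nonempty_free_iso_over_of_basis`, `f_* E` being affine-localizing by ★
`isAffineLocalizing_pushforward_of_isFiniteLocallyFree`) — §1.  If `k = 0`, cohomology and base change (★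
`span_secMod_unitSectionLE_eq_top_of_frame_of_forall_fieldPoint`) kills every section of every cartesian fibre `X₀`, so the
covering hypothesis `⨆ X₀_{s_i} = X₀` of a fibre embedding forces `X₀ = ∅`, hence `X = ∅` and `f` is projective trivially — §2.
If `k = m + 1`, ★ `isProjective_of_pushforwardFrame` (EGA III 4.7.1 with a frame, [EGAIII1, Thm. 4.7.1]) fed by ★
`fibres_embedding_of_fieldExtension` concludes — §3.  §4 restates both heads with the fibre embedding read in ANY rank-one frame system
of ANY module isomorphic to `E|_{X₀}` (Hartshorne II Thm. 7.1: the morphism to `ℙⁿ` depends only on the isomorphism class of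
`(𝓛, (t_i))` — ★ `GeneratingSections.ofCocycleSections_ofFrameSystem_eq_of_iso`), the form a consumer whose fibre embedding is produced
for a different model of the fibre line bundle (e.g. `L^Δ(λ₀)^{⊗3}` of the closed fibre) pays directly.

References.
* [EGAIII1] A. Grothendieck, EGA III (première partie), Publ. Math. IHÉS 11 (1961), Thm. 4.7.1.
* [MumfordAV1970] D. Mumford, Abelian Varieties (1970), §5 Cor. 2 (p. 50), Cor. 3 (p. 53).
* [Hartshorne1977] R. Hartshorne, Algebraic Geometry (1977), III Ex. 5.7 (b), III Thm. 12.11 (p. 290), II §4 (p. 103).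
-/

noncomputable section

-- `TopCat.Presheaf`/`Scheme.Modules` and pull-back bookkeeping (as in ★ `Morphisms/ProjectiveOfPushforwardFrame`).
set_option backward.isDefEq.respectTransparency false

open CategoryTheory CategoryTheory.Limits CategoryTheory.Abelian AlgebraicGeometry TopologicalSpace Opposite
open Literature.AlgebraicGeometry.Modules
open Literature.AlgebraicGeometry.Motives Literature.AlgebraicGeometry.Motives.GeneratingSections

namespace Literature.AlgebraicGeometry.Morphisms

/-! ## §1 Over a local Noetherian base the direct image of a cohomologically flat bundle is framed -/

section Frame

variable {A : Type} [CommRing A] [IsNoetherianRing A] [IsLocalRing A] {X : Scheme.{0}}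
  (f : X ⟶ Spec (CommRingCat.of A)) [IsProper f] [Flat f]

omit [IsNoetherianRing A] in
/-- `Γ(Spec A, 𝒪)` is a local ring when `A` is (transport along `Γ(Spec A, 𝒪) ≅ A`). [folklore]
[cite: Hartshorne1977, II Prop. 2.2 (c)] -/
theorem isLocalRing_sections_top_Spec : IsLocalRing Γ(Spec (CommRingCat.of A), ⊤) :=
  haveI : Nontrivial Γ(Spec (CommRingCat.of A), ⊤) :=
    (Scheme.ΓSpecIso (CommRingCat.of A)).symm.commRingCatIsoToRingEquiv.injective.nontrivial
  IsLocalRing.of_surjective' (Scheme.ΓSpecIso (CommRingCat.of A)).inv.hom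
    (Scheme.ΓSpecIso (CommRingCat.of A)).symm.commRingCatIsoToRingEquiv.surjective

/-- **Mumford §5 Cor. 2 over a LOCAL base: `f_* E` is FREE, i.e. framed.**  `A` Noetherian local, `f : X → Spec A` proper flat,
`E` finite locally free with `Ext¹(𝒪_{X_y}, E|_{X_y}) = 0` on every scheme-theoretic fibre `X_y`; then there is a frame
`𝒪_{Spec A}^k ≅ f_* E` over `Spec A`: `Γ(X, E)` is finitely generated projective over `Γ(Spec A, 𝒪)` (★
`finite_and_projective_secMod_top_of_forall_fiber`), hence free over the local ring, and a basis of `Γ(Spec A, f_* E) = Γ(X, E)`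
is a frame of the affine-localizing module `f_* E` (★ `nonempty_free_iso_over_of_basis`).
[cite: MumfordAV1970, §5 Cor. 2 (p. 50)] [cite: Hartshorne1977, III Thm. 12.11 (p. 290)] -/
theorem exists_free_iso_pushforward_over_top_of_isLocalRing (E : X.Modules) (hL : IsFiniteLocallyFree E)
    (hvan : ∀ y : Spec (CommRingCat.of A),
      Subsingleton (Ext.{1} (unitModule (f.fiber y)) ((Scheme.Modules.pullback (f.fiberι y)).obj E) 1)) :
    ∃ k : ℕ, Nonempty (SheafOfModules.free (Fin k) ≅ ((Scheme.Modules.pushforward f).obj E).over ⊤) := by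
  obtain ⟨hfin₁, hproj₁⟩ := finite_and_projective_secMod_top_of_forall_fiber f E hL hvan
  let R : Type := Γ(Spec (CommRingCat.of A), ⊤)
  let M₁ : Type := SecMod E f.appTop.hom ⊤
  let M₂ : Type := Γ((Scheme.Modules.pushforward f).obj E, ⊤)
  haveI : IsLocalRing R := isLocalRing_sections_top_Spec
  -- the ring map on global sections: `toSections f♯ (f⁻¹ Spec A) = f♯` (note `f ⁻¹ᵁ ⊤ = ⊤` definitionally)
  -- (`f.preimage_top : f ⁻¹ᵁ ⊤ = ⊤` is `rfl`, so this is `f.appLE ⊤ (f ⁻¹ᵁ ⊤) le_rfl = f.app ⊤`, Mathlib `appLE_eq_app`)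
  have htoS : ∀ a : R, toSections f.appTop.hom (f ⁻¹ᵁ ⊤) a = f.app ⊤ a := fun a ↦
    congrArg (fun φ : Γ(Spec (CommRingCat.of A), ⊤) ⟶ Γ(X, f ⁻¹ᵁ ⊤) ↦ φ a) (Scheme.Hom.appLE_eq_app f (U := ⊤))
  -- `Γ(Spec A, f_* E) = Γ(X, E)` with the SAME `Γ(Spec A, 𝒪)`-action (through `f♯`): a linear identification
  let μ : M₁ ≃ₗ[R] M₂ :=
    { toFun := fun t => show Γ(E, f ⁻¹ᵁ ⊤) from SecMod.val (L := E) (ρ := f.appTop.hom) t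
      invFun := fun m => SecMod.mk (L := E) (ρ := f.appTop.hom) (U := ⊤) (show Γ(E, f ⁻¹ᵁ ⊤) from m)
      left_inv := fun _ => rfl
      right_inv := fun _ => rfl
      map_add' := fun _ _ => rfl
      map_smul' := fun a t => by
        change toSections f.appTop.hom (f ⁻¹ᵁ ⊤) a • SecMod.val (L := E) (ρ := f.appTop.hom) (U := f ⁻¹ᵁ ⊤) t =
          f.app ⊤ a • SecMod.val (L := E) (ρ := f.appTop.hom) (U := f ⁻¹ᵁ ⊤) t
        rw [htoS] }
  haveI : Module.Finite R M₁ := hfin₁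
  haveI : Module.Projective R M₁ := hproj₁
  haveI : Module.Finite R M₂ := Module.Finite.equiv μ
  haveI : Module.Projective R M₂ := Module.Projective.of_equiv μ
  haveI : Module.Free R M₂ := Module.free_of_flat_of_isLocalRing
  haveI : Fintype (Module.Free.ChooseBasisIndex R M₂) := Module.Free.ChooseBasisIndex.fintype R M₂
  let b : Module.Basis (Fin (Fintype.card (Module.Free.ChooseBasisIndex R M₂))) R M₂ :=
    (Module.Free.chooseBasis R M₂).reindex (Fintype.equivFin _)
  have hM : IsAffineLocalizing ((Scheme.Modules.pushforward f).obj E) :=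
    isAffineLocalizing_pushforward_of_isFiniteLocallyFree f hL
  exact ⟨_, nonempty_free_iso_over_of_basis _ hM (isAffineOpen_top _) b⟩

end Frame

/-! ## §2 The degenerate case: a frame with NO sections forces every embedded fibre, hence `X`, to be empty -/

section Empty

/-- **A morphism from an EMPTY scheme is projective** (the empty scheme is a closed subscheme of `ℙ⁰_Y`).
[cite: Hartshorne1977, II §4 Definition p.103 (projective morphism)] -/
theorem isProjective_of_isEmpty {X Y : Scheme.{0}} [IsEmpty X] (f : X ⟶ Y) : IsProjective f :=
  ⟨PEmpty, inferInstance, isInitialOfIsEmpty.to _, inferInstance, isInitialOfIsEmpty.hom_ext _ _⟩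

variable {X T X₀ : Scheme.{0}} [IsLocallyNoetherian T] (f : X ⟶ T) [IsProper f] [Flat f] (E : X.Modules)
  (hL : IsFiniteLocallyFree E) (e : SheafOfModules.free (Fin 0) ≅ ((Scheme.Modules.pushforward f).obj E).over ⊤)
  (hvan : ∀ ⦃K : Type⦄ [Field K] ⦃X₀ : Scheme.{0}⦄ (i : X₀ ⟶ X) (f₀ : X₀ ⟶ Spec (CommRingCat.of K))
    (x : Spec (CommRingCat.of K) ⟶ T), IsPullback i f₀ f x →
      Subsingleton (Ext.{1} (unitModule X₀) ((Scheme.Modules.pullback i).obj E) 1))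
  {K : Type} [CommRing K] {iK : Spec (.of K) ⟶ T} {iX : X₀ ⟶ X} {f₀ : X₀ ⟶ Spec (.of K)} (HX : IsPullback iX f₀ f iK)

include hL e hvan HX in
/-- **If `f_* E ≅ 𝒪^0` then every cartesian fibre of `E` has only the zero section** (cohomology and base change: the
fibre sections are spanned by the restricted frame sections, ★ `span_secMod_unitSectionLE_eq_top_of_frame_of_forall_fieldPoint`,
and the frame is empty). [cite: MumfordAV1970, §5 Cor. 3 (p. 53)] [cite: Hartshorne1977, III Thm. 12.11 (p. 290)] -/
theorem eq_zero_of_free_fin_zero_iso_pushforward (s : Γ((Scheme.Modules.pullback iX).obj E, ⊤)) : s = 0 := by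
  have hspan := span_secMod_unitSectionLE_eq_top_of_frame_of_forall_fieldPoint f E hL e hvan HX
  rw [Set.range_eq_empty, Submodule.span_empty] at hspan
  have hm : SecMod.mk (L := (Scheme.Modules.pullback iX).obj E) (ρ := f₀.appTop.hom) (U := ⊤) s ∈
      (⊥ : Submodule Γ(Spec (.of K), ⊤) (SecMod ((Scheme.Modules.pullback iX).obj E) f₀.appTop.hom ⊤)) := by
    rw [hspan]
    exact Submodule.mem_top
  rw [Submodule.mem_bot] at hm
  exact congrArg (SecMod.val (L := (Scheme.Modules.pullback iX).obj E) (ρ := f₀.appTop.hom)) hm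

omit [IsLocallyNoetherian T] [IsProper f] [Flat f] in
/-- **Sections that are all zero cover nothing**: if the non-vanishing loci `X₀_{s_i}` of sections `s_i = 0` of a framed
rank-one module cover `X₀`, then `X₀` is empty (every coefficient `coeffAt i x` vanishes, so every `X₀_{s_i}` is empty).
[cite: Hartshorne1977, II proof of Thm. 7.1] -/
theorem isEmpty_of_iSup_basicOpen_coeff_eq_top_of_forall_eq_zero {X₀ : Scheme.{0}} {E₀ : X₀.Modules}
    (G : FrameSystem E₀) (h : ∀ x, G.rank x = 1) {ι : Type} (s : ι → Γ(E₀, ⊤)) (hs : ∀ i, s i = 0)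
    (hcov : ⨆ i, ⨆ x, X₀.basicOpen ((CocycleSections.ofFrameSystem G h s).coeff i x) = ⊤) : IsEmpty X₀ := by
  refine ⟨fun z ↦ ?_⟩
  have hc : ∀ i x, (CocycleSections.ofFrameSystem G h s).coeff i x = 0 := by
    intro i x
    rw [CocycleSections.ofFrameSystem_coeff]
    unfold GeneratingSections.coeffAt
    rw [hs i, map_zero, coord_zero]
  have hz : z ∈ (⊤ : X₀.Opens) := trivial
  rw [← hcov] at hz
  obtain ⟨i, hz⟩ := Opens.mem_iSup.1 hz
  obtain ⟨x, hz⟩ := Opens.mem_iSup.1 hz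
  rw [hc, Scheme.basicOpen_zero] at hz
  exact hz

end Empty

/-! ## §3 EGA III 4.7.1 over a local base -/

section Projective

variable {A : Type} [CommRing A] [IsNoetherianRing A] [IsLocalRing A] {X : Scheme.{0}}
  (f : X ⟶ Spec (CommRingCat.of A)) [IsProper f] [Flat f] {E : X.Modules} (F : FrameSystem E) (h1 : ∀ x, F.rank x = 1)
  (hvan : ∀ ⦃K : Type⦄ [Field K] ⦃X₀ : Scheme.{0}⦄ (i : X₀ ⟶ X) (f₀ : X₀ ⟶ Spec (CommRingCat.of K))
    (x : Spec (CommRingCat.of K) ⟶ Spec (CommRingCat.of A)), IsPullback i f₀ f x →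
      Subsingleton (Ext.{1} (unitModule X₀) ((Scheme.Modules.pullback i).obj E) 1))

omit [IsNoetherianRing A] [IsLocalRing A] [IsProper f] [Flat f] in
include hvan in
/-- The fibrewise `Ext¹`-vanishing over field points specialised to Mathlib's canonical fibres `f.fiber y`
(the square `f.fiberι y, f.fiberToSpecResidueField y` is cartesian over `Spec κ(y) → Spec A`). [folklore]
[cite: Hartshorne1977, III Thm. 12.11 (p. 290), the fibre `X_y`] -/
theorem subsingleton_ext_fiber_of_forall_fieldPoint (y : Spec (CommRingCat.of A)) :
    Subsingleton (Ext.{1} (unitModule (f.fiber y)) ((Scheme.Modules.pullback (f.fiberι y)).obj E) 1) :=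
  hvan _ _ _ (IsPullback.of_hasPullback f ((Spec (CommRingCat.of A)).fromSpecResidueField y))

include h1 hvan in
/-- **EGA III 4.7.1 / Mumford §5 Cor. 3 over a LOCAL Noetherian base, fibre-presentation form.**  `A` Noetherian local,
`f : X → Spec A` proper flat, `E` with a rank-one frame system and `Ext¹(𝒪, E|_{X₀}) = 0` on every cartesian fibre over a
field point; if every `t ∈ Spec A` has a fibre presentation `X₀ = X ×_{Spec A} Spec K` (any cartesian square over some
`Spec K → Spec A` through which `Spec κ(t)` factors) embedded into `ℙⁿ_K` by finitely many sections of `iX^* E` that generate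
it, then `f` is PROJECTIVE.  (Frame of `f_* E` from §1; an empty frame forces `X = ∅` by §2; otherwise ★
`isProjective_of_pushforwardFrame`.)
[cite: EGAIII1, Thm. 4.7.1] [cite: MumfordAV1970, §5 Cor. 3 (p. 53)] [cite: Hartshorne1977, III Ex. 5.7 (b)] -/
theorem isProjective_of_isLocalRing_of_fibrePresentation
    (H : ∀ t : Spec (CommRingCat.of A), ∃ (K : Type) (_ : CommRing K) (iK : Spec (.of K) ⟶ Spec (CommRingCat.of A))
      (σ : Spec ((Spec (CommRingCat.of A)).residueField t) ⟶ Spec (.of K))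
      (_ : σ ≫ iK = (Spec (CommRingCat.of A)).fromSpecResidueField t) (X₀ : Scheme.{0}) (iX : X₀ ⟶ X)
      (f₀ : X₀ ⟶ Spec (.of K)) (_ : IsPullback iX f₀ f iK) (h1₀ : ∀ x, (F.pullback iX).rank x = 1) (n : ℕ)
      (s : Fin (n + 1) → Γ((Scheme.Modules.pullback iX).obj E, ⊤))
      (hcov : ⨆ i, ⨆ x, X₀.basicOpen ((CocycleSections.ofFrameSystem (F.pullback iX) h1₀ s).coeff i x) = ⊤),
      IsClosedImmersion ((ofCocycleSections (F.pullback iX).U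
        (CocycleSections.ofFrameSystem (F.pullback iX) h1₀ s) hcov).toProj f₀)) :
    IsProjective f := by
  obtain ⟨k, ⟨e⟩⟩ := exists_free_iso_pushforward_over_top_of_isLocalRing f E F.isFiniteLocallyFree
    (subsingleton_ext_fiber_of_forall_fieldPoint f hvan)
  cases k with
  | succ m => exact isProjective_of_pushforwardFrame f F h1 e hvan H
  | zero =>
    rcases isEmpty_or_nonempty X with hX | ⟨⟨x⟩⟩
    · exact isProjective_of_isEmpty f
    obtain ⟨K, _, iK, σ, hσ, X₀, iX, f₀, HX, h1₀, n, s, hcov, -⟩ := H (f x)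
    -- a point of `X₀` over `x`
    let pt : Spec (.of K) := σ (IsLocalRing.closedPoint ((Spec (CommRingCat.of A)).residueField (f x)))
    have hpt : f x = iK pt := by
      change f x = (σ ≫ iK) (IsLocalRing.closedPoint _)
      rw [hσ]
      exact (Scheme.fromSpecResidueField_apply (f x) _).symm
    obtain ⟨z, -, -⟩ := Scheme.Pullback.exists_preimage_pullback x pt hpt
    exact ((isEmpty_of_iSup_basicOpen_coeff_eq_top_of_forall_eq_zero (F.pullback iX) h1₀ s
      (fun i ↦ eq_zero_of_free_fin_zero_iso_pushforward f E F.isFiniteLocallyFree e hvan HX (s i)) hcov).false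
        (HX.isoPullback.inv z)).elim

include h1 hvan in
/-- **EGA III 4.7.1 / Mumford §5 Cor. 3 over a LOCAL Noetherian base, field-extension form** (the shape a consumer with a lifted
polarisation pays): `A` Noetherian local (e.g. Artin local), `f : X → Spec A` proper flat, `E` with a rank-one frame system and
`Ext¹(𝒪, E|_{X₀}) = 0` on every cartesian fibre over a field point; if for every `t ∈ Spec A` there is a field extension
`κ(t) → K` over which the fibre `X_K = X ×_{Spec A} Spec K` is embedded into `ℙⁿ_K` by finitely many sections of `E|_{X_K}`
generating it, then `f` is PROJECTIVE: `X ↪ ℙ^m_{Spec A}` is a closed immersion over `Spec A` (by the frame sections of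
`f_* E ≅ 𝒪^{m+1}`, §1, and ★ `isProjective_of_pushforwardFrame` ∘ ★ `fibres_embedding_of_fieldExtension`; an empty frame forces
`X = ∅`, §2).  «`E` ample on the closed fibre ⇒ `E` ample on `X`» for `X` proper flat over an Artin local ring is the case
`Spec A = {𝔪}`. [cite: EGAIII1, Thm. 4.7.1] [cite: MumfordAV1970, §5 Cor. 3 (p. 53)] [cite: Hartshorne1977, III Ex. 5.7 (b)] -/
theorem isProjective_of_isLocalRing_of_fibre_fieldExtension
    (H : ∀ t : Spec (CommRingCat.of A), ∃ (K : Type) (_ : Field K) (j : (Spec (CommRingCat.of A)).residueField t →+* K)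
      (X₀ : Scheme.{0}) (iX : X₀ ⟶ X) (f₀ : X₀ ⟶ Spec (.of K))
      (_ : IsPullback iX f₀ f (Spec.map (CommRingCat.ofHom j) ≫ (Spec (CommRingCat.of A)).fromSpecResidueField t))
      (h1₀ : ∀ x, (F.pullback iX).rank x = 1) (n : ℕ) (s : Fin (n + 1) → Γ((Scheme.Modules.pullback iX).obj E, ⊤))
      (hcov : ⨆ i, ⨆ x, X₀.basicOpen ((CocycleSections.ofFrameSystem (F.pullback iX) h1₀ s).coeff i x) = ⊤),
      IsClosedImmersion ((ofCocycleSections (F.pullback iX).U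
        (CocycleSections.ofFrameSystem (F.pullback iX) h1₀ s) hcov).toProj f₀)) :
    IsProjective f := by
  obtain ⟨k, ⟨e⟩⟩ := exists_free_iso_pushforward_over_top_of_isLocalRing f E F.isFiniteLocallyFree
    (subsingleton_ext_fiber_of_forall_fieldPoint f hvan)
  cases k with
  | succ m => exact isProjective_of_pushforwardFrame f F h1 e hvan (fibres_embedding_of_fieldExtension f F h1 e hvan H)
  | zero =>
    rcases isEmpty_or_nonempty X with hX | ⟨⟨x⟩⟩
    · exact isProjective_of_isEmpty f
    obtain ⟨K, _, j, X₀, iX, f₀, HX, h1₀, n, s, hcov, -⟩ := H (f x)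
    -- a point of `X₀` over `x`
    let pt : Spec (.of K) := IsLocalRing.closedPoint K
    have hpt : f x = (Spec.map (CommRingCat.ofHom j) ≫ (Spec (CommRingCat.of A)).fromSpecResidueField (f x)) pt := by
      rw [Scheme.Hom.comp_apply]
      exact (Scheme.fromSpecResidueField_apply (f x) _).symm
    obtain ⟨z, -, -⟩ := Scheme.Pullback.exists_preimage_pullback x pt hpt
    exact ((isEmpty_of_iSup_basicOpen_coeff_eq_top_of_forall_eq_zero (F.pullback iX) h1₀ s
      (fun i ↦ eq_zero_of_free_fin_zero_iso_pushforward f E F.isFiniteLocallyFree e hvan HX (s i)) hcov).false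
        (HX.isoPullback.inv z)).elim

end Projective

/-! ## §4 The same heads with the fibre embedding read in any frames of any model of `E|_{X₀}` -/

section OfIso

variable {A : Type} [CommRing A] [IsNoetherianRing A] [IsLocalRing A] {X : Scheme.{0}}
  (f : X ⟶ Spec (CommRingCat.of A)) [IsProper f] [Flat f] {E : X.Modules} (F : FrameSystem E) (h1 : ∀ x, F.rank x = 1)
  (hvan : ∀ ⦃K : Type⦄ [Field K] ⦃X₀ : Scheme.{0}⦄ (i : X₀ ⟶ X) (f₀ : X₀ ⟶ Spec (CommRingCat.of K))
    (x : Spec (CommRingCat.of K) ⟶ Spec (CommRingCat.of A)), IsPullback i f₀ f x →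
      Subsingleton (Ext.{1} (unitModule X₀) ((Scheme.Modules.pullback i).obj E) 1))

include h1 hvan in
/-- **EGA III 4.7.1 over a local base, fibre-presentation form, embedding read in ANY frames of ANY model `E₀ ≅ iX^* E`**: as
`isProjective_of_isLocalRing_of_fibrePresentation`, but the sections `s_i` embedding the presented fibre `X₀` may be sections of any
`𝒪_{X₀}`-module `E₀` with an isomorphism `φ : E₀ ≅ iX^* E`, with coefficients read in any rank-one frame system `G₀` of `E₀` — the
generating-sections datum, hence the morphism `X₀ → ℙⁿ_K`, of `(E₀, s)` in `G₀` is that of `(iX^* E, φ(s))` in `F|_{X₀}` (★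
`GeneratingSections.ofCocycleSections_ofFrameSystem_eq_of_iso`, Hartshorne II Thm. 7.1).
[cite: EGAIII1, Thm. 4.7.1] [cite: Hartshorne1977, II Thm. 7.1] [cite: MumfordAV1970, §5 Cor. 3 (p. 53)] -/
theorem isProjective_of_isLocalRing_of_fibrePresentation_of_iso
    (H : ∀ t : Spec (CommRingCat.of A), ∃ (K : Type) (_ : CommRing K) (iK : Spec (.of K) ⟶ Spec (CommRingCat.of A))
      (σ : Spec ((Spec (CommRingCat.of A)).residueField t) ⟶ Spec (.of K))
      (_ : σ ≫ iK = (Spec (CommRingCat.of A)).fromSpecResidueField t) (X₀ : Scheme.{0}) (iX : X₀ ⟶ X)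
      (f₀ : X₀ ⟶ Spec (.of K)) (_ : IsPullback iX f₀ f iK) (E₀ : X₀.Modules) (_ : E₀ ≅ (Scheme.Modules.pullback iX).obj E)
      (G₀ : FrameSystem E₀) (h₀ : ∀ x, G₀.rank x = 1) (n : ℕ) (s : Fin (n + 1) → Γ(E₀, ⊤))
      (hcov : ⨆ i, ⨆ x, X₀.basicOpen ((CocycleSections.ofFrameSystem G₀ h₀ s).coeff i x) = ⊤),
      IsClosedImmersion ((ofCocycleSections G₀.U (CocycleSections.ofFrameSystem G₀ h₀ s) hcov).toProj f₀)) :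
    IsProjective f := by
  refine isProjective_of_isLocalRing_of_fibrePresentation f F h1 hvan fun t ↦ ?_
  obtain ⟨K, _, iK, σ, hσ, X₀, iX, f₀, HX, E₀, φ, G₀, h₀, n, s, hcov, Hemb⟩ := H t
  have h1₀ : ∀ x, (F.pullback iX).rank x = 1 := fun x ↦ h1 (iX.base x)
  obtain ⟨hcov', -⟩ := ofCocycleSections_ofFrameSystem_eq_of_iso φ G₀ (F.pullback iX) h₀ h1₀ s hcov
  refine ⟨K, inferInstance, iK, σ, hσ, X₀, iX, f₀, HX, h1₀, n, fun j ↦ φ.hom.app ⊤ (s j), hcov', ?_⟩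
  rw [← toProj_ofFrameSystem_eq_of_iso φ G₀ (F.pullback iX) h₀ h1₀ s f₀ hcov hcov']
  exact Hemb

include h1 hvan in
/-- **EGA III 4.7.1 over a local base, field-extension form, embedding read in ANY frames of ANY model `E₀ ≅ iX^* E`**: as
`isProjective_of_isLocalRing_of_fibre_fieldExtension`, but for every `t` the fibre `X_K` over the field extension `κ(t) → K` may be
presented by any cartesian square, and the embedding sections may be sections of any `𝒪_{X_K}`-module `E₀ ≅ iX^* E` with coefficients
in any rank-one frame system of `E₀` (★ `GeneratingSections.ofCocycleSections_ofFrameSystem_eq_of_iso`, Hartshorne II Thm. 7.1) —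
e.g. `E₀ = L^Δ(λ₀)^{⊗3}` on the base change of a polarised closed fibre, embedded by the theorem of Lefschetz.
[cite: EGAIII1, Thm. 4.7.1] [cite: Hartshorne1977, II Thm. 7.1] [cite: MumfordAV1970, §5 Cor. 3 (p. 53)] -/
theorem isProjective_of_isLocalRing_of_fibre_fieldExtension_of_iso
    (H : ∀ t : Spec (CommRingCat.of A), ∃ (K : Type) (_ : Field K) (j : (Spec (CommRingCat.of A)).residueField t →+* K)
      (X₀ : Scheme.{0}) (iX : X₀ ⟶ X) (f₀ : X₀ ⟶ Spec (.of K))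
      (_ : IsPullback iX f₀ f (Spec.map (CommRingCat.ofHom j) ≫ (Spec (CommRingCat.of A)).fromSpecResidueField t))
      (E₀ : X₀.Modules) (_ : E₀ ≅ (Scheme.Modules.pullback iX).obj E) (G₀ : FrameSystem E₀) (h₀ : ∀ x, G₀.rank x = 1)
      (n : ℕ) (s : Fin (n + 1) → Γ(E₀, ⊤))
      (hcov : ⨆ i, ⨆ x, X₀.basicOpen ((CocycleSections.ofFrameSystem G₀ h₀ s).coeff i x) = ⊤),
      IsClosedImmersion ((ofCocycleSections G₀.U (CocycleSections.ofFrameSystem G₀ h₀ s) hcov).toProj f₀)) :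
    IsProjective f := by
  refine isProjective_of_isLocalRing_of_fibre_fieldExtension f F h1 hvan fun t ↦ ?_
  obtain ⟨K, _, j, X₀, iX, f₀, HX, E₀, φ, G₀, h₀, n, s, hcov, Hemb⟩ := H t
  have h1₀ : ∀ x, (F.pullback iX).rank x = 1 := fun x ↦ h1 (iX.base x)
  obtain ⟨hcov', -⟩ := ofCocycleSections_ofFrameSystem_eq_of_iso φ G₀ (F.pullback iX) h₀ h1₀ s hcov
  refine ⟨K, inferInstance, j, X₀, iX, f₀, HX, h1₀, n, fun j ↦ φ.hom.app ⊤ (s j), hcov', ?_⟩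
  rw [← toProj_ofFrameSystem_eq_of_iso φ G₀ (F.pullback iX) h₀ h1₀ s f₀ hcov hcov']
  exact Hemb

end OfIso

end Literature.AlgebraicGeometry.Morphisms

end
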